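import Summits.Ventures.HSemireg.CensusG8Verdict
import HarnessLib

/-!
# Venture HSemireg — CENSUS-g8 ADDENDA: the five post-signature §2 lines of `target-g8/CENSUS.md` **v1.274** `7744dc4867915f69`
# (fold 2026-08-23T12:54:24Z by ACTING PEN t-7 g29 for custodian t-21, lead g7 GO bus l.12306, WAKE `HOME/t-21/WAKE-census-g8-fold.md`)
# next to the SIGNED list `CensusG8.census` (v1.273 `8eb43b237c4e60ad` = the 03:00Z numbers of VERDICT-G6 v1.0 `1651dcc7322662a2`
# § g = 8), and the three-outcome form re-evaluated on the LIVING table `census ++ addenda`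

HONEST FRAMING. Part of the Lean index of the computation cell `pub-hsemireg` (seat p9 gen 2, Sunday typer § g = 8; companion of
`CensusG8Table.lean` ∕ `CensusG8Verdict.lean`, p9 g1). BOOKKEEPING ∕ TRANSCRIPTION ONLY: the five new §2 lines are transcribed cell
for cell by the g1 reading rules (module docstring of `CensusG8Table.lean`: `cls` = c5 with c7, `sigma` = c6 with c7, `verdict` = the
leading token of the custodian's ∕ acting pen's VERDICT words in c10, `kind`, `status` per the roll-up line); no engine number is
recomputed, no object is constructed, and the SIGNED list `census` is NOT edited (append-only tree rule; it encodes the signed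
state). Nothing here says that HC ∕ HC_CM ∕ HC_AV holds; no object is certified; a row is a row; «NOT semiregular» is the engines'
statement in their declared (formal) models, ×-counted as the census prints it.

THE FIVE LINES (CENSUS-g8 v1.274 changelog «LIVING TABLE: 152 counted (161 listed; 163 §2 table lines): A 43 · B 75 · C 3 · P 5 · D 17 ·
K 9; listed-not-counted 9; CLASS-OK (family-B tally) 16; SEMIREG ∧ CLASS 0; vacuity gating 0; candidates 0; VERDICT-G6 v1.0 … NUMBERS OF
RECORD UNCHANGED (148 ∕ 156; A 43 · B 74 · C 3 · P 5 · D 14 · K 9)»; the acting pen placed the authors' ids SLT-p1-1 ∕ SLT-p1-2 ∕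
W5N7-HIT-1 in §2.D with a D-prefix «so that p9's Row.family keeps its six constructors»):
* `BPAL-20` (census l.119, family B, t-20 g6; WAKE item (2)): PALEY TWO-FLAT ADFP SLICES — c5∕c6 «n∕a (NOT-AN-OBJECT row)»; c10 «σ = id: NO
  at slice level (certified ×4, DRAT) … σ = Frob: OPEN at slice level … family-B verdict UNCHANGED: 0 candidates, no object»; c11 «no
  (NOT-AN-OBJECT ∕ negative sub-door row)» ⇒ `structureRow ∕ none ∕ none ∕ structural` (as g1 read the sibling ADFP rows BTFL-20 ∕ BX2G-20).
* `DSLT-p1-1`, `DSLT-p1-2` (l.196–197, family D, p1 g13 CENSUS-ROW-p1.md `3d55f6e97a654df7`; WAKE item (1)): the k = 12 LEVEL-TRANSITIVE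
  K-SECANT COORDINATE DESIGNS on E⁴ (G = ℤ∕12: 15 designs; G = ℤ∕6×ℤ∕2: 45), K = ℚ(√−15); c5 «K-SECANT … ×2 codes p1; ×2 across seats
  ref-4» ⇒ `ok`; c6∕c10 (pen's VERDICT CELL) «NOT-SEMIREG (σ-DEAD ×2 ACROSS CODES on the G-invariant part — ker τ₂∣(Ext²)^G = 244 [class α,
  48 designs] ∕ 240 [class β, 12]; by COUNT alone e₂^G ∈ {266, 262} > 28) ∧ CLASS-OK (K-secant ×2); NOT a candidate; … R-105 (b′) BRANCH 3
  «OPEN-scope: (H1) holds (s(b) = 0), (H3) FAILS (e₂^G = 266 ∕ 262 ≠ 12); no law of (S3) tested as registered; σ-DEAD ×2» + dated NOTE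
  reading (A)» (t-8 l.11117 ∣ t-26 l.11549, 60∕60 ALL-EQUAL) ⇒ `member ∕ ok ∕ obstructed ∕ classOkNotSemireg`, counted.
* `DW5N7-HIT-1` (l.198, family D, W5 sub-lead l.11305; WAKE item (5)): the fully-R′ K-secant pure principal COORDINATE SKELETON of 72
  translated abelian surfaces in E⁴, cell (12, −13∕2), K = ℚ(√−23); c5 «FACTOR CLASS K-SECANT … ×2 ACROSS SEATS AND CODES» (box class not yet
  computed) ; c10 = lead R-108 (f) words «… Ext• (1,36,208,36,1) NOT semiregular ×2 ACROSS CODES (t-26 l.11363 ∣ t-8 l.11689), e₂ = 208 ≠ 12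
  ⇒ (H3) FAILS ⇒ BRANCH 3 «OPEN-scope with (H3) named; σ-DEAD BY COUNT (Σ5: 208 > 28); parity leg of (S3) NOT exercised» … — i.e.
  NOT-SEMIREG (σ-DEAD BY COUNT ×2 ACROSS CODES) ∧ CLASS K-SECANT ×2; … not a candidate» ⇒ `member ∕ ok ∕ obstructed ∕ classOkNotSemireg`,
  counted (the «count» is the tree's `FormulaN.PinchN4.finrank_le_finrank_ker_add_28`: e₂ = 208 > 28 = dim ⊕_q H^{q+2}(E⁴, Ω^q)).
* `DW5N7-HITS-2` (l.199, family D; POINTER ROW by the acting pen, «LISTED, NOT COUNTED»): the 21 «STAR» designs; c5 «K-SECANT class ×2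
  ACROSS SEATS AND CODES»; c6∕c10 «NOT-SEMIREG (σ-DEAD BY COUNT ×2 ACROSS CODES) ∧ CLASS K-SECANT ×2 … (BRANCH 3 …; parity leg of (S3) not
  exercised); … not candidates» ⇒ `member ∕ ok ∕ obstructed ∕ classOkNotSemireg`, listedNotCounted.
Cell updates of EXISTING signed rows at v1.274 (A17-J13 owner amend, A17-J11 c7∕c9, BTFL-20 c9 ×2 note, P22-6 c9, §0 POINTERS 17–20 incl.
the p9 kernel column) are NOT mirrored here: `census` carries the signed cells; the Lean readings of those rows (`cls ∕ sigma ∕ verdict`)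
are unchanged by the v1.274 texts (A17-J13 stays OPEN LEAD ×1 with its det-2 part negative; BTFL-20 structural).

CONTENT (all by `decide`; namespace `Summit.Ventures.HSemireg.CensusG8`): `addenda : List Row` (the five lines, census file order);
`addenda_ids`, `addenda_cells`; `addenda_no_yes_row` (no addendum is CLASS-OK ∧ σ-injective); `addenda_objects_classOk_obstructed`
(the four object lines are exactly the count-barrier rows: cls ok ∧ sigma obstructed); the LIVING-TABLE roll-up `living_lines` (163),
`living_listed` (161), `living_counted` (152), `living_counted_by_family` (43, 75, 3, 5, 17, 9), `living_listedNotCounted_ids` (the signed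
8 + DW5N7-HITS-2), `living_semireg_and_class_count` (0), `living_no_allObject_barrier`, and **`outcome_v1274 : outcome (census ++ addenda)
= .noInFamiliesTried`** — the signed form is unchanged by the fold; `signed_numbers_unchanged` restates g1's 158 ∕ 156 ∕ 148 on `census`.
-/

namespace Summit.Ventures.HSemireg.CensusG8

/-- **The five post-signature §2 lines of CENSUS-g8 v1.274 `7744dc4867915f69`** (acting-pen fold 2026-08-23T12:54:24Z), in census file
order (l.119, l.196–l.199), cells by the g1 reading rules; `tally := false` (the family-B CLASS-OK tally of record stays the signed 16).
[bookkeeping] -/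
def addenda : List Row := [
  ⟨"BPAL-20", .B, .counted, 4, .structureRow, .none, .none, .structural, false⟩,
  ⟨"DSLT-p1-1", .D, .counted, 4, .member, .ok, .obstructed, .classOkNotSemireg, false⟩,
  ⟨"DSLT-p1-2", .D, .counted, 4, .member, .ok, .obstructed, .classOkNotSemireg, false⟩,
  ⟨"DW5N7-HIT-1", .D, .counted, 4, .member, .ok, .obstructed, .classOkNotSemireg, false⟩,
  ⟨"DW5N7-HITS-2", .D, .listedNotCounted, 4, .member, .ok, .obstructed, .classOkNotSemireg, false⟩]

/-- the ids, in file order (the acting pen's D-prefix keeps `Row.family` at six constructors: authors' ids SLT-p1-1 ∕ SLT-p1-2 ∕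
W5N7-HIT-1 ∕ W5N7-HITS-2). [bookkeeping] -/
theorem addenda_ids : addenda.map Row.id = ["BPAL-20", "DSLT-p1-1", "DSLT-p1-2", "DW5N7-HIT-1", "DW5N7-HITS-2"] := by decide

/-- the load-bearing cells (cls, sigma, verdict) of the five lines, as read. [bookkeeping] -/
theorem addenda_cells : addenda.map (fun r => (r.cls, r.sigma, r.verdict)) =
    [(.none, .none, .structural), (.ok, .obstructed, .classOkNotSemireg), (.ok, .obstructed, .classOkNotSemireg),
     (.ok, .obstructed, .classOkNotSemireg), (.ok, .obstructed, .classOkNotSemireg)] := by decide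

/-- **No addendum is a YES row**: none is CLASS-EXACT ∧ W-ALIVE ∧ σ-injective (all four object lines are σ-DEAD ×2, three of them «by
COUNT» — `FormulaN.PinchN4.finrank_le_finrank_ker_add_28`). [bookkeeping; decide] -/
theorem addenda_no_yes_row : ∀ r ∈ addenda, r.semiregAndClass = false := by decide

/-- The four OBJECT lines of the fold are exactly «CLASS-OK ∧ NOT-SEMIREG» rows at n = 4 (the census's new count-barrier ∕ (H3)-fails
rows, R-105 ∕ R-107 ∕ R-108 BRANCH 3), by name. [bookkeeping; decide] -/
theorem addenda_objects_classOk_obstructed :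
    ids addenda (fun r => r.kind == .member) = ["DSLT-p1-1", "DSLT-p1-2", "DW5N7-HIT-1", "DW5N7-HITS-2"] ∧
    (∀ r ∈ addenda, r.kind = .member → r.cls = .ok ∧ r.sigma = .obstructed ∧ r.n = 4) := by decide

/-! ## The LIVING table `census ++ addenda` (CENSUS-g8 v1.274 roll-up of the acting pen; the SIGNED numbers live on `census` alone) -/

/-- 163 §2 table lines = 158 signed physical lines + 5. [bookkeeping] -/
theorem living_lines : (census ++ addenda).length = 163 := by decide +kernel

/-- 161 listed rows (163 − the 2 alias K-lines). [bookkeeping] -/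
theorem living_listed : count (census ++ addenda) (fun r => r.status != .alias) = 161 := by decide +kernel

/-- **152 counted rows** (148 signed + DSLT-p1-1, DSLT-p1-2, BPAL-20, DW5N7-HIT-1). [bookkeeping] -/
theorem living_counted : count (census ++ addenda) (fun r => r.status == .counted) = 152 := by decide +kernel

/-- **A 43 · B 75 · C 3 · P 5 · D 17 · K 9** counted by family in the living table (= the v1.274 changelog; signed: A 43 · B 74 · C 3 ·
P 5 · D 14 · K 9). [bookkeeping] -/
theorem living_counted_by_family :
    (count (census ++ addenda) (fun r => r.status == .counted && r.family == .A),
     count (census ++ addenda) (fun r => r.status == .counted && r.family == .B),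
     count (census ++ addenda) (fun r => r.status == .counted && r.family == .C),
     count (census ++ addenda) (fun r => r.status == .counted && r.family == .P),
     count (census ++ addenda) (fun r => r.status == .counted && r.family == .D),
     count (census ++ addenda) (fun r => r.status == .counted && r.family == .K)) = (43, 75, 3, 5, 17, 9) := by decide +kernel

/-- the 9 LISTED-NOT-COUNTED rows of the living table by name = the signed 8 + the pointer row DW5N7-HITS-2. [bookkeeping] -/
theorem living_listedNotCounted_ids : ids (census ++ addenda) (fun r => r.status == .listedNotCounted) =
    ["A17-J5", "A18-15", "AW3-1", "PS3-3", "P22-4", "P22-5", "P22-5′", "P22-6", "DW5N7-HITS-2"] := by decide +kernel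

/-- **SEMIREG ∧ CLASS = 0 at n = 4 in the living table** (candidates 0). [bookkeeping; decide +kernel] -/
theorem living_semireg_and_class_count : count (census ++ addenda) (fun r => r.atFour && r.semiregAndClass) = 0 := by decide +kernel

/-- no all-object barrier row in the living table («STRUCTURAL-NO NOT CLAIMED» stands). [bookkeeping] -/
theorem living_no_allObject_barrier : ∀ r ∈ census ++ addenda, r.kind ≠ .barrierAllObjects := by decide +kernel

/-- **The three-outcome form on the LIVING table is unchanged by the v1.274 fold: NO-in-families-tried.** [bookkeeping; decide +kernel] -/
theorem outcome_v1274 : outcome (census ++ addenda) = .noInFamiliesTried := by decide +kernel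

/-- The SIGNED numbers are untouched: `census` still has 158 physical ∕ 156 listed ∕ 148 counted lines (g1's `physical_lines` ∕
`listed_rows` ∕ `counted_rows`, restated side by side). [bookkeeping] -/
theorem signed_numbers_unchanged :
    census.length = 158 ∧ count census (fun r => r.status != .alias) = 156 ∧ count census (fun r => r.status == .counted) = 148 :=
  ⟨physical_lines, listed_rows, counted_rows⟩

end Summit.Ventures.HSemireg.CensusG8
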